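import Summits.Schanuel.Schanuel.Theorems.ZilberEacParamCurveLogRootPos
import HarnessLib

/-!
# Polynomially parametrised base curves, XXVIII: the sequence of logarithmically corrected roots
# on the ray WITH ITS POSITION `z₀(j) - (j + K₀ + 1) ω → τ = -r_{d-1}/(d · lc(r))`

HONEST FRAMING.  Cell `pub-schanuel` (Zilber's Exponential-Algebraic Closedness, case ladder;
host summit Schanuel), seat 2, gen 20.  Packaging of files XXVI–XXVII in the format of gen 19's
`exists_ray_roots_log` (file XVI), WITHOUT the escape polynomial `G` (not needed when the
exponential sum has no off-edge part, as for fibre curves `Q ∈ ℂ[t, y₀]`) and WITH the new datum: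
the roots `z₀(j)` of `R(z) - μ log z = 2πi s (j + K₀ + 1)^d + c₀` on the root direction `ω`
satisfy `z₀(j) - (j + K₀ + 1) ω → τ`, `τ = -R_{d-1}/(d · lc(R))` (`exists_ray_roots_log_pos`).
This feeds the engine of file XXIX (zeros of `Q(t, e^{g₀(t)})` with their position to `o(1)`),
used for the vanishing-phase class of Mantova–Masser's density question over polynomial curves.
The question is OPEN in general (PLMS 2024 §1 p. 5); NOT Schanuel's conjecture (neither used
nor implied; EAC ⇏ SC); `EC(3,2)` stays OPEN.
-/

noncomputable section

open Filter Topology Metric Set Complex Polynomial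
open Literature.ModelTheory.Zilber

set_option linter.dupNamespace false

namespace Summit.Schanuel.Schanuel.Theorems

/-- `log(x ν)² / x → 0` along naturals shifted by `K₀` (`ν > 0`). -/
theorem tendsto_log_sq_div_atTop {ν : ℝ} (hν : 0 < ν) (K₀ : ℕ) :
    Tendsto (fun j : ℕ => Real.log ((((j + K₀ : ℕ) : ℝ) + 1) * ν) ^ 2 / (((j + K₀ : ℕ) : ℝ) + 1))
      atTop (𝓝 0) := by
  have hkk : Tendsto (fun j : ℕ => (((j + K₀ : ℕ) : ℝ) + 1)) atTop atTop :=
    (tendsto_natCast_add_atTop 1).comp (tendsto_add_atTop_nat K₀)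
  have hy : Tendsto (fun j : ℕ => (((j + K₀ : ℕ) : ℝ) + 1) * ν) atTop atTop :=
    hkk.atTop_mul_const hν
  have h1 := (Real.tendsto_pow_log_div_mul_add_atTop 1 0 2 one_ne_zero).comp hy
  have h2 : Tendsto (fun j : ℕ => ν * (Real.log ((((j + K₀ : ℕ) : ℝ) + 1) * ν) ^ 2 /
      (1 * ((((j + K₀ : ℕ) : ℝ) + 1) * ν) + 0))) atTop (𝓝 (ν * 0)) := h1.const_mul ν
  rw [mul_zero] at h2
  refine h2.congr fun j => ?_
  have hk : (0 : ℝ) < ((j + K₀ : ℕ) : ℝ) + 1 := by positivity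
  field_simp
  ring

/-- **Logarithmically corrected roots on the ray, with their position.**  `deg R = d ≥ 2`,
`lc(R) ω^d = 2πi s`, `μ ∈ ℝ`, `c₀ ∈ ℂ`.  There are `K₀` and sequences `z₀(j)`, `L(j)` with
`e^{L(j)} = z₀(j)`, `e^{R(z₀(j))} = e^{c₀} e^{μ L(j)}`, `1 ≤ ‖z₀(j)‖`, `2 ≤ ‖lc(R)‖ ‖z₀(j)‖`,
`‖z₀(j)‖ → ∞` and `z₀(j) - (j + K₀ + 1) ω → -R_{d-1}/(d · lc(R))`. (new) -/
theorem exists_ray_roots_log_pos (R : Polynomial ℂ) (hd : 2 ≤ R.natDegree) (ω : ℂ) (s : ℤ)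
    (hs : s = 1 ∨ s = -1) (hω : R.leadingCoeff * ω ^ R.natDegree = 2 * Real.pi * I * s)
    (μ : ℝ) (c₀ : ℂ) :
    ∃ (z₀ Lg : ℕ → ℂ) (K₀ : ℕ), Tendsto (fun j => ‖z₀ j‖) atTop atTop ∧
      Tendsto (fun j => z₀ j - (((j + K₀ : ℕ) : ℂ) + 1) * ω) atTop
        (𝓝 (-(R.coeff (R.natDegree - 1) / (R.natDegree * R.leadingCoeff)))) ∧
      ∀ j, exp (Lg j) = z₀ j ∧ exp (R.eval (z₀ j)) = exp c₀ * exp ((μ : ℂ) * Lg j) ∧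
        1 ≤ ‖z₀ j‖ ∧ 2 ≤ ‖R.leadingCoeff‖ * ‖z₀ j‖ := by
  set d : ℕ := R.natDegree with hd_def
  set a : ℂ := R.leadingCoeff with ha_def
  set ℓ : Polynomial ℂ := R.eraseLead with hℓ_def
  set τ : ℂ := -(R.coeff (d - 1) / (d * a)) with hτ_def
  have hd1 : 1 ≤ d := by omega
  have hR0 : R ≠ 0 := by
    rintro rfl
    rw [hd_def, Polynomial.natDegree_zero] at hd
    omega
  have ha0 : a ≠ 0 := Polynomial.leadingCoeff_ne_zero.2 hR0
  have hapos : 0 < ‖a‖ := norm_pos_iff.2 ha0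
  have hrhs : (2 * Real.pi * I * s : ℂ) ≠ 0 := by
    have hsC : (s : ℂ) ≠ 0 := by rcases hs with rfl | rfl <;> simp
    have hπ : (Real.pi : ℂ) ≠ 0 := Complex.ofReal_ne_zero.mpr Real.pi_pos.ne'
    simp [hsC, hπ, Complex.I_ne_zero]
  have hω0 : ω ≠ 0 := by
    rintro rfl
    rw [zero_pow (by omega), mul_zero] at hω
    exact hrhs hω.symm
  have hωpos : 0 < ‖ω‖ := norm_pos_iff.mpr hω0
  have hπ := Real.pi_pos
  -- constants
  set C₀ : ℝ := coeffNormSum ℓ * (3 * ‖ω‖ + 1) ^ (d - 1) + ‖c₀‖ with hC₀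
  have hC₀0 : 0 ≤ C₀ := by have := coeffNormSum_nonneg ℓ; positivity
  set β : ℂ := R.coeff (d - 1) / (a * ω) with hβ_def
  set S₂ : ℝ := coeffNormSum (R.eraseLead - Polynomial.C (R.coeff (d - 1)) *
    Polynomial.X ^ (d - 1)) * (3 * ‖ω‖ + 1) ^ (d - 2) with hS₂_def
  have hS₂0 : 0 ≤ S₂ := by
    have := coeffNormSum_nonneg (R.eraseLead - Polynomial.C (R.coeff (d - 1)) *
      Polynomial.X ^ (d - 1))
    positivity
  set α : ℝ := ‖c₀‖ + |μ| * 4 + (3 * ‖β‖ + S₂ + 1) with hα_def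
  have hα0 : 0 ≤ α := by positivity
  set Cω : ℝ := ‖ω‖ * (10 + 4 * ‖β‖) with hCω_def
  have hCω0 : 0 ≤ Cω := by positivity
  -- eventual conditions
  have hk1 : Tendsto (fun k : ℕ => (k : ℝ) + 1) atTop atTop := tendsto_natCast_add_atTop 1
  have hev₁ := eventually_alRoot_log_hyp C₀ μ hωpos
  have hev₂ : ∀ᶠ k : ℕ in atTop, 3 ≤ ((k : ℝ) + 1) * ‖ω‖ :=
    (hk1.atTop_mul_const hωpos).eventually_ge_atTop 3
  have hev₃ : ∀ᶠ k : ℕ in atTop, 6 ≤ ‖a‖ * (((k : ℝ) + 1) * ‖ω‖) :=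
    ((hk1.atTop_mul_const hωpos).const_mul_atTop hapos).eventually_ge_atTop 6
  obtain ⟨K₀, hK₀⟩ := eventually_atTop.1 (hev₁.and (hev₂.and hev₃))
  -- the roots at stage `j + K₀`
  have hroot : ∀ j : ℕ, ∃ z₀ Lg : ℂ, exp Lg = z₀ ∧ exp (R.eval z₀) = exp c₀ * exp ((μ : ℂ) * Lg) ∧
      1 ≤ ‖z₀‖ ∧ 2 ≤ ‖a‖ * ‖z₀‖ ∧ (((j + K₀ : ℕ) : ℝ) + 1) * ‖ω‖ / 3 ≤ ‖z₀‖ ∧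
      ‖z₀ - ((((j + K₀ : ℕ) : ℂ) + 1) * ω + τ)‖ ≤
        Cω * (α + |μ| * Real.log ((((j + K₀ : ℕ) : ℝ) + 1) * ‖ω‖)) ^ 2 /
          (((j + K₀ : ℕ) : ℝ) + 1) := by
    intro j
    obtain ⟨⟨h1a, h1b⟩, h2, h3⟩ := hK₀ (j + K₀) (Nat.le_add_left _ _)
    have hkk0 : (0 : ℝ) ≤ ((j + K₀ : ℕ) : ℝ) := Nat.cast_nonneg _
    have hkkpos : (0 : ℝ) < ((j + K₀ : ℕ) : ℝ) + 1 := by linarith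
    have hlog0 : 0 ≤ Real.log ((((j + K₀ : ℕ) : ℝ) + 1) * ‖ω‖) := Real.log_nonneg h1a
    obtain ⟨ζ, L, hζ, -, hLz, hLnorm, hz₀⟩ := exists_alRoot_log_dir_normLog R hd ω s hs hω μ c₀
      (j + K₀) h1a (by rw [← hd_def, ← hℓ_def, ← hC₀]; exact h1b)
    obtain ⟨hup, hlow⟩ := norm_ray_point_bounds ω hd1 (j + K₀) hζ
    -- the position estimate
    set B : ℝ := ‖c₀‖ + |μ| * (Real.log ((((j + K₀ : ℕ) : ℝ) + 1) * ‖ω‖) + 4) with hB_def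
    have hEB : ‖c₀ + (μ : ℂ) * L‖ ≤ B := by
      calc ‖c₀ + (μ : ℂ) * L‖ ≤ ‖c₀‖ + ‖(μ : ℂ) * L‖ := norm_add_le _ _
        _ = ‖c₀‖ + |μ| * ‖L‖ := by rw [norm_mul, Complex.norm_real, Real.norm_eq_abs]
        _ ≤ B := by
            rw [hB_def]
            exact add_le_add le_rfl (mul_le_mul_of_nonneg_left hLnorm (abs_nonneg μ))
    have hE : R.eval ((((j + K₀ : ℕ) : ℂ) + 1) * ω * exp (ζ / R.natDegree)) =
        (((((j + K₀ : ℕ) : ℤ) + 1) ^ R.natDegree * s : ℤ) : ℂ) * (2 * Real.pi * I) +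
          (c₀ + (μ : ℂ) * L) := by
      rw [hz₀, add_assoc]
    have hpos := norm_rayRoot_sub_center_le R hd hs hω (j + K₀) hζ hEB hE
    rw [← hd_def, ← ha_def, ← hβ_def, ← hS₂_def] at hpos
    refine ⟨(((j + K₀ : ℕ) : ℂ) + 1) * ω * exp (ζ / d), L, hLz, ?_, ?_, ?_, ?_, ?_⟩
    · rw [hz₀, Complex.exp_add, Complex.exp_add, Complex.exp_int_mul_two_pi_mul_I, one_mul]
    · push_cast at hlow h2 ⊢; linarith
    · push_cast at hlow h3 ⊢
      have := mul_le_mul_of_nonneg_left hlow hapos.le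
      linarith
    · push_cast at hlow ⊢; linarith
    · have e : (((j + K₀ : ℕ) : ℂ) + 1) * ω * exp (ζ / d) - ((((j + K₀ : ℕ) : ℂ) + 1) * ω + τ) =
          (((j + K₀ : ℕ) : ℂ) + 1) * ω * exp (ζ / d) -
            ((((j + K₀ : ℕ) : ℂ) + 1) * ω - R.coeff (d - 1) / (↑d * a)) := by
        rw [hτ_def]; ring
      rw [e]
      refine hpos.trans (le_of_eq ?_)
      rw [hCω_def, hα_def, hB_def]
      ring
  choose z₀ Lg hLz hz₀e hz₀1 hz₀2 hz₀low hz₀pos using hroot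
  set kk : ℕ → ℝ := fun j => ((j + K₀ : ℕ) : ℝ) + 1 with hkk_def
  have hkk : Tendsto kk atTop atTop := hk1.comp (tendsto_add_atTop_nat K₀)
  have hkkpos : ∀ j, 0 < kk j := fun j => by
    have : (0 : ℝ) ≤ ((j + K₀ : ℕ) : ℝ) := Nat.cast_nonneg _
    simp only [hkk_def]; linarith
  refine ⟨z₀, Lg, K₀, ?_, ?_, fun j => ⟨hLz j, hz₀e j, hz₀1 j, hz₀2 j⟩⟩
  · exact tendsto_atTop_mono (fun j => hz₀low j)
      ((hkk.atTop_mul_const hωpos).atTop_div_const (by norm_num : (0 : ℝ) < 3))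
  · -- the position: squeeze
    have hbound : Tendsto (fun j => Cω * (α + |μ| * Real.log (kk j * ‖ω‖)) ^ 2 / kk j)
        atTop (𝓝 0) := by
      have h1 : Tendsto (fun j => 1 / kk j) atTop (𝓝 0) := tendsto_const_nhds.div_atTop hkk
      have h2 := tendsto_log_sq_div_atTop hωpos K₀
      have h3 : Tendsto (fun j => Cω * (2 * α ^ 2 * (1 / kk j) +
          2 * μ ^ 2 * (Real.log (kk j * ‖ω‖) ^ 2 / kk j))) atTop (𝓝 (Cω * (2 * α ^ 2 * 0 +
          2 * μ ^ 2 * 0))) :=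
        ((h1.const_mul _).add (h2.const_mul _)).const_mul _
      rw [mul_zero, mul_zero, add_zero, mul_zero] at h3
      refine squeeze_zero (fun j => by have := hkkpos j; positivity) (fun j => ?_) h3
      have hsq : (α + |μ| * Real.log (kk j * ‖ω‖)) ^ 2 ≤
          2 * α ^ 2 + 2 * (μ ^ 2 * Real.log (kk j * ‖ω‖) ^ 2) := by
        have h0 := sq_nonneg (α - |μ| * Real.log (kk j * ‖ω‖))
        have e : (|μ| * Real.log (kk j * ‖ω‖)) ^ 2 = μ ^ 2 * Real.log (kk j * ‖ω‖) ^ 2 := by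
          rw [mul_pow, sq_abs]
        nlinarith [h0, e]
      have hk := hkkpos j
      rw [div_le_iff₀ hk]
      have e : Cω * (2 * α ^ 2 * (1 / kk j) + 2 * μ ^ 2 * (Real.log (kk j * ‖ω‖) ^ 2 / kk j)) * kk j =
          Cω * (2 * α ^ 2 + 2 * (μ ^ 2 * Real.log (kk j * ‖ω‖) ^ 2)) := by
        field_simp
      rw [e]
      exact mul_le_mul_of_nonneg_left hsq hCω0
    have hnorm : Tendsto (fun j => ‖z₀ j - ((((j + K₀ : ℕ) : ℂ) + 1) * ω + τ)‖) atTop (𝓝 0) :=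
      squeeze_zero (fun j => norm_nonneg _) (fun j => hz₀pos j) hbound
    have h0 : Tendsto (fun j => z₀ j - ((((j + K₀ : ℕ) : ℂ) + 1) * ω + τ)) atTop (𝓝 0) :=
      tendsto_zero_iff_norm_tendsto_zero.2 hnorm
    have h4 := h0.add_const τ
    rw [zero_add] at h4
    exact h4.congr fun j => by ring

end Summit.Schanuel.Schanuel.Theorems
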